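import Summits.BirchSwinnertonDyer.Rank1Residual.X11b.BDPRouteSelmerCountExact
import HarnessLib

/-!
# X11b, routes p2/R1 — THE EXACT BASE SELMER COUNT assuming only `Ш(E/K)[p^∞]` finite
# (cell `b2b-bsdres`, sub-cell `multr1-p2`, gen 19)

HONEST FRAMING (verbatim, cell `b2b-bsdres`): "We develop the residual theory around the BSD formula
for a specific rank-1 curve class, assuming the known deep theorems (Gross–Zagier, Kolyvagin,
Kato, Skinner–Urban) as cited black boxes (conditional/label B). No claim of proving BSD outright;
every result is labelled (A) Mathlib-unconditional, (B) conditional on cited literature theorems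
stated as hypotheses, or (C) speculative." This file is label **(B)**: CONDITIONAL on the named
facts `poitouTate_selmerStructure_duality K` (Howard 2.1.11 ⟸ Milne ADT I 4.10(b)) and
`localEulerPoincareCharacteristic (K_v)` (Milne ADT I 2.8), hypotheses. Nothing booked; class X11b
stays CONSTRUCTION-SHAPED; no label change; no named fact minted.

## What this file proves

`natCard_selmerAcBase_mul_eq_of_rankOne_primary`, `baseSelmerCountAt_of_rankOne_primary` — gen 19's
exact count `#Sel_𝔭(K,E[p^∞])·#E(ℚ_p)[p^∞] = p^a` (`BDPRouteSelmerCountExact`) and, under (iv), the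
typed atom (P6) `BaseSelmerCountAt p 𝔭 (embAt K p 𝔭) P`, with the input "`Ш(E/K)` finite" WEAKENED
to "`Ш(E/K)[p^∞]` finite" — the form supplied by `p`-adic methods (Kato / Skinner–Urban-type
finiteness of `Ш[p^∞]`, or GZK descent `mordellWeilRank_baseChange_eq_one_and_finite_sha`); only the
`Ш`-bookkeeping changes (`SelmerCount.…_of_finite` / primed lemmas), the proof is otherwise gen 19's.
(Route R1's (P6) on its data was discharged by the sibling seat with the full-`Ш` version,
`RouteR1BaseSelmerCount.r1BaseSelmerCountAt_of_facts`; this file is the `p`-primary strengthening.)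

References: [JetchevSkinnerWan2017] Prop. 3.2.1, (7.1.5); [Castella2018] Thm. 2.3; [Castella2018Erratum]
Thm. 1.1 (iv); [MilneADT2006] I 4.10, 2.8.
-/

noncomputable section

open scoped Classical

open WeierstrassCurve NumberField IsDedekindDomain Field
open Literature.NumberTheory.EllipticCurves Literature.NumberTheory.EllipticCurves.GreenbergSelmer
  Literature.NumberTheory.EllipticCurves.ModularForms
  Literature.NumberTheory.EllipticCurves.Rank1Residual
  Literature.NumberTheory.EllipticCurves.Rank1Residual.Typed
  Literature.NumberTheory.EllipticCurves.Wuthrich2014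
  Literature.NumberTheory.EllipticCurves.BalakrishnanEtAl2019
  Literature.NumberTheory.QuadraticFields.Quadratic
  Literature.NumberTheory.Automorphic
  Literature.NumberTheory.GaloisRepresentations Literature.NumberTheory.GaloisCohomology
  Summit.BirchSwinnertonDyer.Rank1Residual.X11b.AcSelmer
  Summit.BirchSwinnertonDyer.Rank1Residual.X11b.LocBridge

namespace Summit.BirchSwinnertonDyer.Rank1Residual.X11b

/-- **THE EXACT BASE SELMER COUNT at a rank-one datum, assuming only `Ш(E/K)[p^∞]` finite**
(`natCard_selmerAcBase_mul_eq_of_rankOne` asked for all of `Ш(E/K)`): `#Sel_𝔭(K,E[p^∞])·#E(ℚ_p)[p^∞]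
= p^a`, `a = ord_p #Ш[p^∞] + 2((ord_p log_ω P − 1) − ord_p[E(K):ℤP]) + ord_p ∏_{w∣p} c_w` EXACTLY.
Same proof (JSW17 Prop. 3.2.1 with (7.1.5) at one large level). CONDITIONAL on
`poitouTate_selmerStructure_duality K` and `localEulerPoincareCharacteristic (K_v)`, hypotheses.
[cite: JetchevSkinnerWan2017, Prop. 3.2.1 and (7.1.5) (arXiv:1512.06894 pp. 10–11, 16)]
[cite: Castella2018, Thm. 2.3 and its proof, (3.2.1), (calcul) (arXiv:1704.06608 pp. 5–6)]
[cite: MilneADT2006, Ch. I, Thm. 4.10(b) and Thm. 2.8] -/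
theorem natCard_selmerAcBase_mul_eq_of_rankOne_primary (W : WeierstrassCurve ℚ) [W.IsElliptic]
    [W.IsGloballyMinimal] (p : ℕ) [Fact p.Prime] (K : Type) [Field K] [NumberField K]
    (hPT : poitouTate_selmerStructure_duality K)
    (hEP : ∀ v : HeightOneSpectrum (𝓞 K), localEulerPoincareCharacteristic (v.adicCompletion K))
    (hmult : Mult W p) (hirr : Irr W p) (hK : IsImaginaryQuadratic K) (hsplit : SplitsIn K p)
    (hrank : (W.baseChange K).mordellWeilRank = 1)
    (hSha : Finite (AddCommGroup.primaryComponent (W.baseChange K).sha p))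
    (P : (W.baseChange K).toAffine.Point) (hPinf : ¬ IsOfFinAddOrder P)
    (𝔭 : HeightOneSpectrum (𝓞 K)) (h𝔭 : ((p : ℕ) : 𝓞 K) ∈ 𝔭.asIdeal)
    (he : 𝔭.asIdeal.ramificationIdx (𝓞 ℚ) = 1) (hf : 𝔭.asIdeal.inertiaDeg (𝓞 ℚ) = 1) :
    ∃ (_ : Finite (selmerAcBase (W.baseChange K) p 𝔭 ∅)) (a : ℕ),
      Nat.card (selmerAcBase (W.baseChange K) p 𝔭 ∅) *
          Nat.card (AddCommGroup.primaryComponent (W.baseChange ℚ_[p]).toAffine.Point p) = p ^ a ∧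
      (a : ℤ) =
        (padicValNat p (Nat.card (AddCommGroup.primaryComponent (W.baseChange K).sha p)) : ℤ) +
        2 * ((padicLogOrd W p (embAt K p 𝔭 h𝔭 he hf) P - 1) -
          (padicValNat p (AddSubgroup.zmultiples P).index : ℤ)) +
          padicValNat p (tamagawaProductAbove W K p) := by
  revert P
  set E := W.baseChange K with hEdef
  set G := W.baseChange ℚ_[p] with hGdef
  intro P hPinf
  haveI hEK : E.IsElliptic := by rw [hEdef, baseChange]; infer_instance
  have h2 : Module.finrank ℚ K = 2 := hK.1
  haveI : IsTotallyComplex K := hK.2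
  have hKc : ∀ w : InfinitePlace K, w.IsComplex := fun w => IsTotallyComplex.isComplex w
  have hp : p.Prime := Fact.out
  haveI := hSha
  -- finiteness of Castella's Selmer group over `K` (the gen-18 bound at a rank-one datum)
  have hPTsum : poitouTate_sum_localTatePairing_eq_zero K :=
    poitouTate_sum_localTatePairing_eq_zero_of_selmerStructure_duality hPT
  obtain ⟨hfinSel, -⟩ := selmerCardBoundTorsion_of_rankOne_primary W p K hPTsum hEP hmult hirr hK
    hsplit hrank hSha P hPinf 𝔭 h𝔭 he hf
  -- the `p`-adic bookkeeping of gens 16–18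
  set ιp := embAt K p 𝔭 h𝔭 he hf with hιp
  set f : E.toAffine.Point →+ G.toAffine.Point := Affine.Point.map (W' := W) ιp.toRatAlgHom with hfdef
  have hfinj : Function.Injective f := Affine.Point.map_injective (W' := W) ιp.toRatAlgHom
  have hivK : ∀ x : E.toAffine.Point, p • x = 0 → x = 0 :=
    Transvection.forall_torsion_eq_zero_of_irr W p hirr K h2
  obtain ⟨c, Q, hcQ, hcker⟩ := RankOne.exists_coord_of_mordellWeilRank_eq_one E hrank
  have hA : ∀ a : E.toAffine.Point, IsOfFinAddOrder (a - c a • Q) :=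
    RankOne.isOfFinAddOrder_sub_coord_zsmul c Q hcQ hcker
  have hQinf : ¬ IsOfFinAddOrder Q := fun hQ => by
    have h := RankOne.coord_eq_zero_of_isOfFinAddOrder c hQ
    rw [hcQ] at h
    exact one_ne_zero h
  have hxinf : ¬ IsOfFinAddOrder (f Q) := fun hx => hQinf ((hfinj.isOfFinAddOrder_iff).mp hx)
  have hyinf : ¬ IsOfFinAddOrder (f P) := fun hy => hPinf ((hfinj.isOfFinAddOrder_iff).mp hy)
  have hcP : c P ≠ 0 := fun h0 => hPinf (hcker P h0)
  haveI hfi2 : (G.formalFiltration 2).FiniteIndex := G.finiteIndex_formalFiltration 2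
  set cp := padicValNat p (G.localTamagawaNumber ℤ_[p]) with hcpdef
  obtain ⟨φ, hφ⟩ := LocalIndex.exists_addEquiv_valuation_psi_padicPointOf_of_mult W p hmult (K := K)
  obtain ⟨m, hmrange, hmcard, hmle⟩ :=
    LocalIndex.exists_pow_eq_card_and_le_valuation_psi (G.formalFiltration 2) φ
  set Ψ := LocalIndex.psi (G.formalFiltration 2) φ with hΨ
  set eQ := (Ψ (f Q)).valuation with heQdef
  set eP := (Ψ (f P)).valuation with hePdef
  have hΨQ : Ψ (f Q) ≠ 0 := fun h0 => hxinf ((LocalIndex.psi_eq_zero_iff _ φ _).mp h0)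
  have hmeQ : m ≤ eQ := hmle (f Q) hΨQ
  have heP : (eP : ℤ) = padicLogOrd W p ιp P + cp - 1 := hφ ιp P hyinf
  have hyx : f P = c P • f Q + f (P - c P • Q) := by rw [map_sub, map_zsmul]; abel
  have hePQ : eP = padicValNat p (c P).natAbs + eQ := by
    rw [hePdef, hyx]
    exact LocalIndex.valuation_psi_zsmul_add (G.formalFiltration 2) φ hxinf
      (f.isOfFinAddOrder (hA P)) hcP
  haveI : Finite (AddCommGroup.torsion E.toAffine.Point) := E.finite_torsion_point
  have hI : padicValNat p (AddSubgroup.zmultiples P).index = padicValNat p (c P).natAbs :=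
    RankOne.padicValNat_index_zmultiples_eq c Q hcQ hcker hivK P hcP
  have htam : padicValNat p (tamagawaProductAbove W K p) = 2 * cp :=
    LocalIndexTransport.padicValNat_tamagawaProductAbove_eq_two_mul W K p h2 hsplit
  obtain ⟨σ, 𝔮, hσ, hne, h𝔮p, hall⟩ :=
    LocalIndexTransport.exists_conj_prime_of_splitsIn K p h2 hsplit h𝔭
  obtain ⟨t, ht⟩ : ∃ t : ℕ, Nat.card (AddCommGroup.primaryComponent E.sha p) = p ^ t :=
    SelmerCount.exists_natCard_primaryComponent_eq_pow_of_finite p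
  -- the exponent of Castella's Selmer group
  have hcardeq := AcSelmer.natCard_selmerAcBase_eq_natCard_selmerGroup E p 𝔭
    (∅ : Set (HeightOneSpectrum (𝓞 K)))
  haveI hfinH : Finite (acStructure (primaryGaloisModule E p) p 𝔭 ∅).selmerGroup := by
    apply Nat.finite_of_card_ne_zero
    rw [← hcardeq]
    haveI := hfinSel
    exact Nat.card_pos.ne'
  obtain ⟨k₀, -, hk₀⟩ := AcSelmer.exists_pow_nsmul_eq_zero_of_finite
    (acStructure (primaryGaloisModule E p) p 𝔭 ∅).selmerGroup
  -- THE LEVEL `k`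
  set k : ℕ := k₀ + ((eQ - m) + (eQ + t)) + 1 with hkdef
  have hk0 : 0 < k := by omega
  have hjk : eQ + t ≤ k := by omega
  have hsk : (eQ - m) + (eQ + t) ≤ k := by omega
  have hkill : ∀ x ∈ (acStructure (primaryGaloisModule E p) p 𝔭 ∅).selmerGroup, p ^ k • x = 0 := by
    intro x hx
    have hkk : k = (k - k₀) + k₀ := by omega
    rw [hkk, pow_add, mul_nsmul', hk₀ x hx, nsmul_zero]
  have hΓ := SelmerCount.noInvariants_of_forall_torsion_eq_zero E p hivK
  have hcount : Nat.card (selmerAcBase E p 𝔭 ∅) =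
      Nat.card (acLevelStructure E p k 𝔭 ∅).selmerGroup :=
    AcSelmer.natCard_selmerAcBase_eq_natCard_level E p k 𝔭 ∅ E.zsmul_geomPoints_surjective_holds
      hΓ hkill
  -- the symbolic indices at level `k`, read in `E(ℚ_p)` through `Ψ`
  have hN : ((zsmulAddGroupHom ((p ^ k : ℕ) : ℤ) : E.toAffine.Point →+ _).range).index = p ^ k :=
    RankOne.index_range_zsmul_pow_eq c Q hcQ hcker hivK k
  have hM : (AddCommGroup.torsion ((W.baseChange K).baseChange (𝔭.adicCompletion K)).toAffine.Point ⊔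
      (zsmulAddGroupHom ((p ^ k : ℕ) : ℤ) :
        ((W.baseChange K).baseChange (𝔭.adicCompletion K)).toAffine.Point →+ _).range).index =
      p ^ k := by
    rw [index_torsion_sup_range_zsmul_eq_padic K p 𝔭 h𝔭 he hf W,
      RankOne.range_zsmulAddGroupHom_natCast]
    exact LocalIndex.index_torsion_sup_range_nsmul (G.formalFiltration 2) φ k
  have hL₁ : ∀ k' : ℕ, eQ ≤ k' →
      ((Affine.Point.baseChange (W' := W.baseChange K) K (𝔭.adicCompletion K)).range ⊔
        (zsmulAddGroupHom ((p ^ k' : ℕ) : ℤ) :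
          ((W.baseChange K).baseChange (𝔭.adicCompletion K)).toAffine.Point →+ _).range).index =
        p ^ eQ := by
    intro k' hk'
    rw [LocalIndexTransport.index_range_baseChange_sup_eq_padic K p 𝔭 h𝔭 he hf W,
      RankOne.range_zsmulAddGroupHom_natCast, sup_comm]
    change ((nsmulAddMonoidHom (p ^ k') : G.toAffine.Point →+ _).range ⊔ f.range).index = _
    rw [LocalIndex.range_nsmul_sup_range_eq_of_source f c Q hA k' hivK]
    exact LocalIndex.index_range_nsmul_sup_zmultiples_eq_pow_valuation (G.formalFiltration 2) φ
      hmrange hmcard (f Q) hxinf hk'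
  have hL₂ : ∀ k' : ℕ, eQ - m ≤ k' →
      ((Affine.Point.baseChange (W' := W.baseChange K) K (𝔭.adicCompletion K)).range ⊔
        (AddCommGroup.torsion ((W.baseChange K).baseChange (𝔭.adicCompletion K)).toAffine.Point ⊔
          (zsmulAddGroupHom ((p ^ k' : ℕ) : ℤ) :
            ((W.baseChange K).baseChange (𝔭.adicCompletion K)).toAffine.Point →+ _).range)).index =
        p ^ (eQ - m) := by
    intro k' hk'
    rw [index_range_baseChange_sup_torsion_sup_eq_padic K p 𝔭 h𝔭 he hf W,
      RankOne.range_zsmulAddGroupHom_natCast]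
    change (f.range ⊔ (AddCommGroup.torsion G.toAffine.Point ⊔
      (nsmulAddMonoidHom (p ^ k') : G.toAffine.Point →+ _).range)).index = _
    have hrw : f.range ⊔ (AddCommGroup.torsion G.toAffine.Point ⊔
        (nsmulAddMonoidHom (p ^ k') : G.toAffine.Point →+ _).range) =
        AddCommGroup.torsion G.toAffine.Point ⊔
          ((nsmulAddMonoidHom (p ^ k') : G.toAffine.Point →+ _).range ⊔
            AddSubgroup.zmultiples (f Q)) := by
      rw [← LocalIndex.range_nsmul_sup_range_eq_of_source f c Q hA k' hivK]
      ac_rfl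
    rw [hrw, LocalIndex.index_torsion_sup_range_nsmul_sup_zmultiples (G.formalFiltration 2) φ
      hmrange (f Q) hxinf k', min_eq_right hk']
  have hS := SelmerCount.natCard_sha_inf_torsionBy_eq' E p ht (show t ≤ k by omega)
  have hShaj : ∀ z ∈ E.sha ⊓ AddSubgroup.torsionBy E.galH1 ((p ^ k : ℕ) : ℤ), p ^ t • z = 0 :=
    fun z hz => SelmerCount.pow_nsmul_eq_zero_of_mem_sha_inf_torsionBy' E p ht k hz
  -- THE EXACT LEVEL COUNT (gen 19)
  obtain ⟨-, hlevel⟩ := SelmerLevelCount.natCard_level_eq_of_indices W K p k 𝔭 𝔮 hKc hk0 σ hσ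
    h𝔮p hne hall hPT hEP (exceptionalPlaces W K p h2) (inl_mem_exceptionalPlaces h2)
    (fun v hv => inr_mem_exceptionalPlaces_of_mem h2 hv)
    (fun v hv => inr_mem_exceptionalPlaces_of_not_hasGoodReductionAt h2 hv)
    (inr_mem_exceptionalPlaces_of_mem h2 h𝔮p) hivK hjk hsk hN hM (hL₁ k (by omega))
    (hL₁ (k - t) (by omega)) (hL₂ k (by omega)) (hL₂ (k - (eQ + t)) (by omega)) hS hShaj
  -- assemble
  refine ⟨hfinSel, t + 2 * eQ, ?_, ?_⟩
  · rw [← hmcard, hcount, hlevel, ht, ← pow_add, ← pow_add]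
    congr 1
    omega
  · have hvS : padicValNat p (Nat.card (AddCommGroup.primaryComponent E.sha p)) = t := by
      rw [ht, padicValNat.prime_pow]
    rw [hvS, hI, htam]
    have hePQZ : (eP : ℤ) = (padicValNat p (c P).natAbs : ℤ) + (eQ : ℤ) := by exact_mod_cast hePQ
    have hcast : (((t + 2 * eQ : ℕ) : ℤ)) = (t : ℤ) + 2 * (eQ : ℤ) := by push_cast; ring
    have hcast2 : (((2 * cp : ℕ) : ℤ)) = 2 * (cp : ℤ) := by push_cast; ring
    rw [hcast, hcast2]
    linarith [hePQZ, heP]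

/-- **(P6) at a rank-one datum under (iv), only `Ш(E/K)[p^∞]` finite**: literally
`BaseSelmerCountAt p 𝔭 (embAt K p 𝔭) P`. CONDITIONAL on the two cited cohomological facts.
[cite: JetchevSkinnerWan2017, Prop. 3.2.1 and (7.1.5) (arXiv:1512.06894 pp. 10–11, 16)]
[cite: Castella2018Erratum, Thm. 1.1 (iv)] [cite: MilneADT2006, Ch. I, Thm. 4.10(b) and Thm. 2.8] -/
theorem baseSelmerCountAt_of_rankOne_primary (W : WeierstrassCurve ℚ) [W.IsElliptic]
    [W.IsGloballyMinimal] (p : ℕ) [Fact p.Prime] (K : Type) [Field K] [NumberField K]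
    (hPT : poitouTate_selmerStructure_duality K)
    (hEP : ∀ v : HeightOneSpectrum (𝓞 K), localEulerPoincareCharacteristic (v.adicCompletion K))
    (hmult : Mult W p) (hirr : Irr W p) (hK : IsImaginaryQuadratic K) (hsplit : SplitsIn K p)
    (hiv : ∀ R : (W.baseChange ℚ_[p]).toAffine.Point, p • R = 0 → R = 0)
    (hrank : (W.baseChange K).mordellWeilRank = 1)
    (hSha : Finite (AddCommGroup.primaryComponent (W.baseChange K).sha p))
    (P : (W.baseChange K).toAffine.Point) (hPinf : ¬ IsOfFinAddOrder P)
    (𝔭 : HeightOneSpectrum (𝓞 K)) (h𝔭 : ((p : ℕ) : 𝓞 K) ∈ 𝔭.asIdeal)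
    (he : 𝔭.asIdeal.ramificationIdx (𝓞 ℚ) = 1) (hf : 𝔭.asIdeal.inertiaDeg (𝓞 ℚ) = 1) :
    BaseSelmerCountAt p 𝔭 (embAt K p 𝔭 h𝔭 he hf) P := by
  obtain ⟨hfin, a, hcard, ha⟩ := natCard_selmerAcBase_mul_eq_of_rankOne_primary W p K hPT hEP hmult
    hirr hK hsplit hrank hSha P hPinf 𝔭 h𝔭 he hf
  have hbot : AddCommGroup.primaryComponent (W.baseChange ℚ_[p]).toAffine.Point p = ⊥ := by
    refine (AddSubgroup.eq_bot_iff_forall _).mpr fun x hx => ?_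
    obtain ⟨n, hn⟩ := (AddCommGroup.mem_primaryComponent).mp hx
    exact KummerDecomp.eq_zero_of_pow_nsmul_eq_zero p hiv n hn
  have h1 : Nat.card (AddCommGroup.primaryComponent (W.baseChange ℚ_[p]).toAffine.Point p) = 1 := by
    rw [hbot, AddSubgroup.card_bot]
  rw [h1, mul_one] at hcard
  exact ⟨a, ⟨hfin, hcard⟩, ha⟩

end Summit.BirchSwinnertonDyer.Rank1Residual.X11b

end
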